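import Summits.QuantumFields.YangMills.Theorems.BalabanUVNodesN19CosModeLowerBound

/-!
# YM-DAG node N19 (= NE7 proper) — THE LOWER SIDE OF THE KINK, PART 4b: the COSINE face BELOW THE PERIOD
# (`dist_∞(cos(ωΣ_{i≤d}|x_i|), Π_t) ≥ ωk·sin(ωm)∕(40πt)` for frozen ℓ¹-mass `m ≤ d − k`; `≍ ω²d²∕t` for `ωd ≤ π`)

Cell `pub-ymgap`, HUMAN RULING D-0062 (Track A) ∕ D-0149 (work-bound push), R141 (C) wider-strategy seat `pub-ymgap-dag-n19-e` (strategy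
s3 = ALTERNATIVE CURRENCY), generation g32, module 4 (lineage module 142).  Route `Summits/QuantumFields/YangMills/Theses/BalabanUVNodes.lean`,
cluster item K3⁸ «SpineGivenEndpointR13SepCoPHV» (stmt-QuantumFields-27366); filed `--supports` that item `--as helper` (it proves no registered
stub).  COUNT-NEUTRAL: [folklore] over Mathlib (`Complex.exp_bound'`, `Polynomial`) and module 134 `…N19SingleModeLowerBound` BY NAME
(`exists_le_abs_sin_mul_abs_sub_eval`: `E_t(sin(a|x|)) ≥ a∕(20πt)`; `exists_polynomial_restrictLine`, `sum_abs_lineConfig`, `sum_range_two_mul`);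
no laws, no scheme object, no Theses import; NOT a discharge claim.

CONTEXT — CURRENCY-MAP v10's open item «the cosine face for `ωd < π` (second-order kink `|x_i||x_j|`, expected `≍ (ωd)²∕t`)».  Module 135 froze
an ℓ¹-mass of EXACTLY a quarter period (`cos(ω(k|s| + π∕(2ω))) = −sin(ωk|s|)`), which needs `π∕(2ω) ≤ d − k`, i.e. `ωd ≳ π`.  Below the period no
quarter period fits; along the full diagonal `cos(ωd|s|)` is entire (no kink).
THE DEVICE.  Freeze `d − k` coordinates at a common height `b = m∕(d − k) ≤ 1` (frozen mass `m`), let the other `k` equal `s`: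
`cos(ω(k|s| + m)) = cos(ωm)·cos(ωks) − sin(ωm)·sin(ωk|s|)` — an ENTIRE even part plus the kinked sine WEIGHTED BY `sin(ωm)`.  The even cosine
Taylor polynomial `q` of degree `≤ t` is absorbed into the competitor `p` (module 134's sine bound applied to `(cos(ωm)q − p)∕sin(ωm)`), and the
cosine tail costs `2(ωk)^{2K}∕(2K)! ≤ 6ωk∕(3^t·t)` (`ωk ≤ t∕10`, `n! ≥ (n∕e)^n`):
§1 `re_cexp_taylor` · `abs_cos_sub_evenPowerSum_le` (`|cos y − Σ_{k<K}(−1)^k y^{2k}∕(2k)!| ≤ 2|y|^{2K}∕(2K)!` for `|y| ≤ (2K+1)∕2`) · §2 ★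
`exists_le_abs_cosMixed_sub_eval` (dimension one: `E_t(γcos(a·) − σsin(a|·|)) ≥ σa∕(20πt) − 6a∕(3^t t)` for `|γ| ≤ 1`, `σ ≥ 0`, `a ≤ t∕10`,
`t ≥ 6`) · §3 ★★ `exists_le_abs_cos_l1Norm_sub_eval_frozenMass` (the cube: `≥ ωk·sin(ωm)∕(20πt) − 6ωk∕(3^t t)` for `k ≤ d`, `0 ≤ m ≤ d − k`,
`sin(ωm) ≥ 0`, `ωk ≤ t∕10`) · ★★ `exists_le_abs_cos_l1Norm_sub_eval_of_sin_ge` (clean form: `≥ ωk·sin(ωm)∕(40πt)` once `240π ≤ 3^t·sin(ωm)`) ·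
★★ `exists_le_abs_cos_l1Norm_sub_eval_subPeriod` (`ωd ≤ π`, `k = ⌊d∕2⌋`, `m = d − ⌊d∕2⌋`: `≥ ω⌊d∕2⌋·sin(ω(d − ⌊d∕2⌋))∕(40πt)`).
READING (honest): for `ωd ≤ π` the cosine face is `≳ ω⌊d∕2⌋·sin(ω⌈d∕2⌉)∕(40πt) ≥ ω²⌊d∕2⌋⌈d∕2⌉∕(20π²t)` (`sin y ≥ 2y∕π`) — the SECOND-ORDER kink
`≍ ω²d²∕t`, interpolating continuously to module 135's `ω⌊d∕2⌋∕(20πt)` when `ω⌈d∕2⌉` reaches `π∕2`; the matching upper side `≲ (cosh(ωd) − 1)∕t`-type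
is modules 116∕117's (`≍ ω²d²∕t` for `ωd ≤ 1`, up to their Taylor-degree factor); constants not optimised.

HONEST FRAMING (binding).  Elementary and [folklore]; degree model; NO consumer in the DAG today (an optimality map of the seat's own currency);
nothing of Bałaban's instantiated; NE7 NOT PRINTED, NOT proved; N19 NOT discharged; count-neutral.  One finite `T⁴` programme at fixed `ε`; nothing
continuum ∕ `ℝ⁴` ∕ OS ∕ mass-gap ∕ Clay.  0 `def` ∕ 0 `sorry`.
-/

noncomputable section

open Finset Real Polynomial Complex

namespace Summit.QuantumFields.YangMills.Theorems.BalabanUVNodesN19CosModeLowerBoundSubPeriod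

open Summit.QuantumFields.YangMills.Theorems.BalabanUVNodesN19SingleModeLowerBound
  (sum_range_two_mul exists_le_abs_sin_mul_abs_sub_eval exists_polynomial_restrictLine sum_abs_lineConfig)

/-! ## §1 The cosine Taylor tail [folklore] -/

/-- The real part of the Taylor polynomial of `e^{iy}` of even order is the even-power sum:
`Re Σ_{j<2K}(iy)^j∕j! = Σ_{k<K}(−1)^k y^{2k}∕(2k)!`. [folklore] -/
theorem re_cexp_taylor (y : ℝ) (K : ℕ) :
    (∑ j ∈ range (2 * K), ((y : ℂ) * I) ^ j / (j.factorial : ℂ)).re =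
      ∑ k ∈ range K, (-1) ^ k * y ^ (2 * k) / ((2 * k).factorial : ℝ) := by
  rw [sum_range_two_mul, Complex.re_sum]
  refine Finset.sum_congr rfl fun k _ => ?_
  have hev : ((y : ℂ) * I) ^ (2 * k) = ((y ^ (2 * k) * (-1) ^ k : ℝ) : ℂ) := by
    rw [mul_pow, pow_mul Complex.I 2 k, Complex.I_sq]
    push_cast
    ring
  have hodd : ((y : ℂ) * I) ^ (2 * k + 1) = ((y ^ (2 * k + 1) * (-1) ^ k : ℝ) : ℂ) * I := by
    rw [pow_succ, hev]
    push_cast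
    ring
  have e1 : (((y ^ (2 * k) * (-1) ^ k : ℝ) : ℂ) / ((2 * k).factorial : ℂ)).re =
      y ^ (2 * k) * (-1) ^ k / ((2 * k).factorial : ℝ) := by
    rw [show ((2 * k).factorial : ℂ) = (((2 * k).factorial : ℝ) : ℂ) by norm_cast, ← Complex.ofReal_div,
      Complex.ofReal_re]
  have e2 : (((y ^ (2 * k + 1) * (-1) ^ k : ℝ) : ℂ) * I / ((2 * k + 1).factorial : ℂ)).re = 0 := by
    set r : ℝ := y ^ (2 * k + 1) * (-1) ^ k with hr
    rw [show ((2 * k + 1).factorial : ℂ) = (((2 * k + 1).factorial : ℝ) : ℂ) by norm_cast, mul_div_right_comm,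
      ← Complex.ofReal_div, Complex.re_ofReal_mul, Complex.I_re, mul_zero]
  rw [Complex.add_re, hev, hodd, e1, e2]
  ring

/-- **THE COSINE TAYLOR TAIL.**  `|cos y − Σ_{k<K}(−1)^k y^{2k}∕(2k)!| ≤ 2|y|^{2K}∕(2K)!` whenever `|y| ≤ (2K+1)∕2`
(Mathlib's `Complex.exp_bound'` at `iy`, real parts). [folklore] -/
theorem abs_cos_sub_evenPowerSum_le (y : ℝ) (K : ℕ) (hy : |y| ≤ (2 * K + 1) / 2) :
    |Real.cos y - ∑ k ∈ range K, (-1) ^ k * y ^ (2 * k) / ((2 * k).factorial : ℝ)| ≤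
      2 * |y| ^ (2 * K) / ((2 * K).factorial : ℝ) := by
  have hnorm : ‖(y : ℂ) * I‖ = |y| := by simp
  have hx : ‖(y : ℂ) * I‖ / ((2 * K).succ : ℕ) ≤ 1 / 2 := by
    rw [hnorm, div_le_iff₀ (by positivity)]
    push_cast
    linarith
  have hb := Complex.exp_bound' hx
  rw [hnorm] at hb
  have hre : (Complex.exp ((y : ℂ) * I) - ∑ j ∈ range (2 * K), ((y : ℂ) * I) ^ j / (j.factorial : ℂ)).re =
      Real.cos y - ∑ k ∈ range K, (-1) ^ k * y ^ (2 * k) / ((2 * k).factorial : ℝ) := by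
    rw [Complex.sub_re, Complex.exp_ofReal_mul_I_re, re_cexp_taylor]
  rw [← hre]
  refine (Complex.abs_re_le_norm _).trans (hb.trans_eq ?_)
  ring

/-! ## §2 ★ Dimension one: an entire even part plus a weighted kinked sine [folklore] -/

/-- ★ **`E_t(γ·cos(ax) − σ·sin(a|x|)) ≥ σa∕(20πt) − 6a∕(3^t·t)`.**  For `t ≥ 6`, `0 ≤ a ≤ t∕10`, `|γ| ≤ 1`, `σ ≥ 0` and every real polynomial `p`
of degree `≤ t` there is `x ∈ [−1,1]` with `|γcos(ax) − σsin(a|x|) − p(x)| ≥ σa∕(20πt) − 6a∕(3^t t)`.  With `2n₀ + 1 ≤ t ≤ 2n₀ + 2` and `q` the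
cosine Taylor polynomial `Σ_{k≤n₀}(−1)^k(aX)^{2k}∕(2k)!` (degree `≤ t`): module 134 applied to `(γq − p)∕σ` gives `x` with
`|γq(x) − σsin(a|x|) − p(x)| ≥ σa∕(20πt)`, and `|γ(cos(ax) − q(x))| ≤ 2a^{2n₀+2}∕(2n₀+2)! ≤ 2a·3^{−(2n₀+1)}∕t ≤ 6a∕(3^t t)`
(`a^n∕n! ≤ (ae∕n)^n ≤ 3^{−n}` as `ae ≤ n∕3`). [folklore] -/
theorem exists_le_abs_cosMixed_sub_eval {t : ℕ} (ht : 6 ≤ t) {a : ℝ} (ha : 0 ≤ a) (hat : a ≤ t / 10) {γ σ : ℝ}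
    (hγ : |γ| ≤ 1) (hσ : 0 ≤ σ) (p : ℝ[X]) (hp : p.natDegree ≤ t) :
    ∃ x ∈ Set.Icc (-1 : ℝ) 1,
      σ * a / (20 * π * t) - 6 * a / (3 ^ t * t) ≤ |γ * Real.cos (a * x) - σ * Real.sin (a * |x|) - p.eval x| := by
  have ht6 : (6 : ℝ) ≤ t := by exact_mod_cast ht
  have ht0 : (0 : ℝ) < t := by linarith
  have htail0 : 0 ≤ 6 * a / (3 ^ t * t) := by positivity
  -- the degenerate weight
  rcases hσ.eq_or_lt with hσ0 | hσpos
  · refine ⟨0, ⟨by norm_num, by norm_num⟩, ?_⟩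
    rw [← hσ0, zero_mul, zero_div, zero_sub]
    exact (neg_nonpos.2 htail0).trans (abs_nonneg _)
  -- the truncation order: `n₀ = ⌊(t−1)/2⌋`, `2n₀ + 1 ≤ t ≤ 2n₀ + 2`
  obtain ⟨n₀, hn₀, hn₀'⟩ : ∃ n₀ : ℕ, 2 * n₀ + 1 ≤ t ∧ t ≤ 2 * n₀ + 2 := ⟨(t - 1) / 2, by omega, by omega⟩
  -- the cosine Taylor polynomial
  set q : ℝ[X] := ∑ k ∈ range (n₀ + 1), Polynomial.C ((-1 : ℝ) ^ k * a ^ (2 * k) / ((2 * k).factorial : ℝ)) *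
    Polynomial.X ^ (2 * k) with hq
  have hqdeg : q.natDegree ≤ t := by
    refine Polynomial.natDegree_sum_le_of_forall_le _ _ fun k hk => (Polynomial.natDegree_C_mul_X_pow_le _ _).trans ?_
    have := Finset.mem_range.1 hk
    omega
  have hqeval : ∀ x : ℝ, q.eval x = ∑ k ∈ range (n₀ + 1), (-1) ^ k * (a * x) ^ (2 * k) / ((2 * k).factorial : ℝ) := by
    intro x
    rw [hq, Polynomial.eval_finsetSum]
    refine Finset.sum_congr rfl fun k _ => ?_
    rw [Polynomial.eval_mul, Polynomial.eval_C, Polynomial.eval_pow, Polynomial.eval_X, mul_pow]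
    ring
  -- module 134 applied to `(γq − p)/σ`
  set r : ℝ[X] := Polynomial.C σ⁻¹ * (Polynomial.C γ * q - p) with hr
  have hrdeg : r.natDegree ≤ t := by
    refine (Polynomial.natDegree_C_mul_le _ _).trans ((Polynomial.natDegree_sub_le _ _).trans (max_le ?_ hp))
    exact (Polynomial.natDegree_C_mul_le _ _).trans hqdeg
  obtain ⟨x, hx, hmain⟩ := exists_le_abs_sin_mul_abs_sub_eval ht ha hat r hrdeg
  refine ⟨x, hx, ?_⟩
  have hx1 : |x| ≤ 1 := abs_le.2 ⟨hx.1, hx.2⟩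
  have hreval : r.eval x = σ⁻¹ * (γ * q.eval x - p.eval x) := by
    rw [hr, Polynomial.eval_mul, Polynomial.eval_C, Polynomial.eval_sub, Polynomial.eval_mul, Polynomial.eval_C]
  -- `σ a/(20πt) ≤ |γ q(x) − σ sin(a|x|) − p(x)|`
  have hmain' : σ * a / (20 * π * t) ≤ |γ * q.eval x - σ * Real.sin (a * |x|) - p.eval x| := by
    have h1 := mul_le_mul_of_nonneg_left hmain hσ
    rw [hreval, ← abs_of_pos hσpos, ← abs_mul, abs_of_pos hσpos] at h1
    have e : σ * (Real.sin (a * |x|) - σ⁻¹ * (γ * q.eval x - p.eval x)) = -(γ * q.eval x - σ * Real.sin (a * |x|) - p.eval x) := by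
      field_simp
      ring
    rw [e, abs_neg] at h1
    calc σ * a / (20 * π * t) = σ * (a / (20 * π * t)) := by ring
      _ ≤ _ := h1
  -- the cosine tail `|γ (cos(ax) − q(x))| ≤ 6a/(3^t t)`
  have hy : |a * x| ≤ (2 * ((n₀ + 1 : ℕ) : ℝ) + 1) / 2 := by
    rw [abs_mul, abs_of_nonneg ha]
    have h1 : a * |x| ≤ a := by nlinarith [abs_nonneg x]
    have h2 : (t : ℝ) ≤ 2 * n₀ + 2 := by exact_mod_cast hn₀'
    push_cast
    nlinarith
  have htail := abs_cos_sub_evenPowerSum_le (a * x) (n₀ + 1) hy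
  rw [← hqeval x] at htail
  set n' : ℕ := 2 * n₀ + 1 with hn'
  have hn'5 : (5 : ℝ) ≤ n' := by
    have : 5 ≤ n' := by omega
    exact_mod_cast this
  have hn't : (t : ℝ) - 1 ≤ n' := by
    have : t - 1 ≤ n' := by omega
    have h' : ((t - 1 : ℕ) : ℝ) = (t : ℝ) - 1 := by rw [Nat.cast_sub (by omega)]; simp
    rw [← h']
    exact_mod_cast this
  have hn'0 : (0 : ℝ) < n' := by linarith
  have hfac : (n' : ℝ) ^ n' / (n'.factorial : ℝ) ≤ Real.exp 1 ^ n' := by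
    have := Real.pow_div_factorial_le_exp (n' : ℝ) (Nat.cast_nonneg n') n'
    rwa [show ((n' : ℕ) : ℝ) = (n' : ℝ) * 1 by ring, Real.exp_nat_mul, mul_one] at this
  have hfac0 : (0 : ℝ) < n'.factorial := by positivity
  have hr3 : a * Real.exp 1 / n' ≤ 1 / 3 := by
    rw [div_le_div_iff₀ hn'0 (by norm_num : (0 : ℝ) < 3)]
    have he := Real.exp_one_lt_d9
    nlinarith [Real.exp_pos 1]
  have hr30 : 0 ≤ a * Real.exp 1 / n' := by positivity
  -- `a^{n'}/n'! ≤ (1/3)^{n'} ≤ (1/3)^{t-1}`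
  have hpow : a ^ n' / (n'.factorial : ℝ) ≤ (1 / 3 : ℝ) ^ (t - 1) := by
    have h1 : a ^ n' / (n'.factorial : ℝ) ≤ (a * Real.exp 1 / n') ^ n' := by
      rw [div_pow, mul_pow, div_le_div_iff₀ hfac0 (by positivity)]
      have hnn : (n' : ℝ) ^ n' ≤ Real.exp 1 ^ n' * n'.factorial := by
        rwa [div_le_iff₀ hfac0] at hfac
      calc a ^ n' * (n' : ℝ) ^ n' ≤ a ^ n' * (Real.exp 1 ^ n' * n'.factorial) :=
            mul_le_mul_of_nonneg_left hnn (pow_nonneg ha _)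
        _ = a ^ n' * Real.exp 1 ^ n' * n'.factorial := by ring
    calc a ^ n' / (n'.factorial : ℝ) ≤ (a * Real.exp 1 / n') ^ n' := h1
      _ ≤ (1 / 3 : ℝ) ^ n' := pow_le_pow_left₀ hr30 hr3 _
      _ ≤ (1 / 3 : ℝ) ^ (t - 1) := pow_le_pow_of_le_one (by norm_num) (by norm_num) (by omega)
  have h3t : (1 / 3 : ℝ) ^ (t - 1) = 3 / 3 ^ t := by
    obtain ⟨t', rfl⟩ : ∃ t', t = t' + 1 := ⟨t - 1, by omega⟩
    rw [Nat.add_sub_cancel, pow_succ, one_div, inv_pow]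
    field_simp
  have htail' : 2 * |a * x| ^ (2 * (n₀ + 1)) / ((2 * (n₀ + 1)).factorial : ℝ) ≤ 6 * a / (3 ^ t * t) := by
    have hax : |a * x| ≤ a := by rw [abs_mul, abs_of_nonneg ha]; nlinarith [abs_nonneg x]
    have hax0 : 0 ≤ |a * x| := abs_nonneg _
    have h2 : 2 * (n₀ + 1) = n' + 1 := by omega
    rw [h2, Nat.factorial_succ, pow_succ]
    push_cast
    have hn1t : (t : ℝ) ≤ (n' : ℝ) + 1 := by linarith
    have h3pos : (0 : ℝ) < 3 ^ t := by positivity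
    calc 2 * (|a * x| ^ n' * |a * x|) / (((n' : ℝ) + 1) * n'.factorial)
        ≤ 2 * (a ^ n' * a) / (((n' : ℝ) + 1) * n'.factorial) := by gcongr
      _ = 2 * a * (a ^ n' / n'.factorial) / ((n' : ℝ) + 1) := by field_simp
      _ ≤ 2 * a * (1 / 3 : ℝ) ^ (t - 1) / ((n' : ℝ) + 1) := by gcongr
      _ ≤ 2 * a * (1 / 3 : ℝ) ^ (t - 1) / t := by gcongr
      _ = 6 * a / (3 ^ t * t) := by rw [h3t]; field_simp; ring
  have hγtail : |γ * Real.cos (a * x) - γ * q.eval x| ≤ 6 * a / (3 ^ t * t) := by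
    rw [← mul_sub, abs_mul]
    calc |γ| * |Real.cos (a * x) - q.eval x| ≤ 1 * (2 * |a * x| ^ (2 * (n₀ + 1)) / ((2 * (n₀ + 1)).factorial : ℝ)) :=
          mul_le_mul hγ htail (abs_nonneg _) zero_le_one
      _ ≤ 6 * a / (3 ^ t * t) := by rw [one_mul]; exact htail'
  -- triangle inequality
  have hsplit : γ * q.eval x - σ * Real.sin (a * |x|) - p.eval x =
      (γ * Real.cos (a * x) - σ * Real.sin (a * |x|) - p.eval x) - (γ * Real.cos (a * x) - γ * q.eval x) := by ring
  have htri : |γ * q.eval x - σ * Real.sin (a * |x|) - p.eval x| ≤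
      |γ * Real.cos (a * x) - σ * Real.sin (a * |x|) - p.eval x| + |γ * Real.cos (a * x) - γ * q.eval x| := by
    rw [hsplit]; exact abs_sub _ _
  linarith

/-! ## §3 ★★ The cube: frozen ℓ¹-mass below a quarter period [folklore] -/

variable {ι : Type*} [Fintype ι] [DecidableEq ι]

/-- ★★ **THE COSINE FACE WITH FROZEN MASS `m`.**  For `t ≥ 6`, `ω ≥ 0`, `k ≤ |ι|`, `ωk ≤ t∕10`, a frozen mass `0 ≤ m ≤ |ι| − k` with `sin(ωm) ≥ 0`,
and every `P : MvPolynomial ι ℝ` of total degree `≤ t`, there is `x ∈ [−1,1]^ι` with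
`|cos(ωΣ_i|x_i|) − P(x)| ≥ ωk·sin(ωm)∕(20πt) − 6ωk∕(3^t·t)` (`k` coordinates equal to `s`, the other `|ι| − k` frozen at the common height
`m∕(|ι| − k) ≤ 1`; along this line `cos(ωΣ_i|x_i|) = cos(ωm)cos(ωks) − sin(ωm)sin(ωk|s|)`, and §2 applies with `γ = cos(ωm)`, `σ = sin(ωm)`).
[folklore] -/
theorem exists_le_abs_cos_l1Norm_sub_eval_frozenMass {t : ℕ} (ht : 6 ≤ t) {ω : ℝ} (hω : 0 ≤ ω) {k : ℕ} (hk : k ≤ Fintype.card ι)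
    (hωk : ω * k ≤ t / 10) {m : ℝ} (hm0 : 0 ≤ m) (hm : m ≤ Fintype.card ι - k) (hsin : 0 ≤ Real.sin (ω * m))
    (P : MvPolynomial ι ℝ) (hP : P.totalDegree ≤ t) :
    ∃ x : ι → ℝ, (∀ i, x i ∈ Set.Icc (-1 : ℝ) 1) ∧
      ω * k * Real.sin (ω * m) / (20 * π * t) - 6 * (ω * k) / (3 ^ t * t) ≤
        |Real.cos (ω * ∑ i, |x i|) - MvPolynomial.eval x P| := by
  obtain ⟨A, -, hA⟩ := Finset.exists_subset_card_eq (s := (Finset.univ : Finset ι)) (n := k)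
    (by simpa [Finset.card_univ] using hk)
  -- the frozen height `b = m/(|ι| − k) ∈ [0, 1]` (or `0` if `k = |ι|`, when `m = 0`)
  obtain ⟨b, hb0, hb1, hbmass⟩ : ∃ b : ℝ, 0 ≤ b ∧ b ≤ 1 ∧ ((Fintype.card ι : ℝ) - k) * b = m := by
    rcases (sub_nonneg.2 (show (k : ℝ) ≤ Fintype.card ι by exact_mod_cast hk)).eq_or_lt with h0 | hpos
    · refine ⟨0, le_rfl, zero_le_one, ?_⟩
      rw [← h0] at hm
      rw [mul_zero]; linarith
    · exact ⟨m / ((Fintype.card ι : ℝ) - k), div_nonneg hm0 hpos.le, by rw [div_le_one hpos]; exact hm,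
        mul_div_cancel₀ _ hpos.ne'⟩
  set x₀ : ι → ℝ := fun i => if i ∈ A then 0 else b with hx₀
  set v : ι → ℝ := fun i => if i ∈ A then 1 else 0 with hv
  obtain ⟨p, hpdeg, hpev⟩ := exists_polynomial_restrictLine P x₀ v
  have hγ : |Real.cos (ω * m)| ≤ 1 := Real.abs_cos_le_one _
  obtain ⟨s, hs, h⟩ := exists_le_abs_cosMixed_sub_eval ht (mul_nonneg hω (Nat.cast_nonneg k)) hωk hγ hsin p (hpdeg.trans hP)
  refine ⟨fun i => x₀ i + s * v i, fun i => ?_, ?_⟩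
  · simp only [hx₀, hv]
    split_ifs
    · simpa using hs
    · simp only [mul_zero, add_zero, Set.mem_Icc]
      exact ⟨by linarith, hb1⟩
  have hsum : ∑ i, |x₀ i + s * v i| = k * |s| + m := by
    simp only [hx₀, hv]
    rw [sum_abs_lineConfig A hb0 s, hA, hbmass]
  have hphase : Real.cos (ω * (k * |s| + m)) =
      Real.cos (ω * m) * Real.cos (ω * k * s) - Real.sin (ω * m) * Real.sin (ω * k * |s|) := by
    have hcos : Real.cos (ω * k * |s|) = Real.cos (ω * k * s) := by
      rcases le_total 0 s with h0 | h0
      · rw [abs_of_nonneg h0]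
      · rw [abs_of_nonpos h0, mul_neg, Real.cos_neg]
    rw [show ω * (k * |s| + m) = ω * k * |s| + ω * m by ring, Real.cos_add, hcos]
    ring
  rw [hsum, ← hpev s, hphase]
  calc ω * k * Real.sin (ω * m) / (20 * π * t) - 6 * (ω * k) / (3 ^ t * t)
      = Real.sin (ω * m) * (ω * k) / (20 * π * t) - 6 * (ω * k) / (3 ^ t * t) := by ring
    _ ≤ _ := h

/-- ★★ **CLEAN FORM: `dist_∞(cos(ωΣ_{i}|x_i|), Π_t) ≥ ωk·sin(ωm)∕(40πt)` once `240π ≤ 3^t·sin(ωm)`** (then the cosine tail `6ωk∕(3^t t)` is at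
most half of `ωk·sin(ωm)∕(20πt)`).  Same data as the previous theorem. [folklore] -/
theorem exists_le_abs_cos_l1Norm_sub_eval_of_sin_ge {t : ℕ} (ht : 6 ≤ t) {ω : ℝ} (hω : 0 ≤ ω) {k : ℕ} (hk : k ≤ Fintype.card ι)
    (hωk : ω * k ≤ t / 10) {m : ℝ} (hm0 : 0 ≤ m) (hm : m ≤ Fintype.card ι - k) (hsin : 240 * π ≤ 3 ^ t * Real.sin (ω * m))
    (P : MvPolynomial ι ℝ) (hP : P.totalDegree ≤ t) :
    ∃ x : ι → ℝ, (∀ i, x i ∈ Set.Icc (-1 : ℝ) 1) ∧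
      ω * k * Real.sin (ω * m) / (40 * π * t) ≤ |Real.cos (ω * ∑ i, |x i|) - MvPolynomial.eval x P| := by
  have h3 : (0 : ℝ) < 3 ^ t := by positivity
  have ht0 : (0 : ℝ) < t := by exact_mod_cast (show 0 < t by omega)
  have hsin0 : 0 ≤ Real.sin (ω * m) := by
    have : 0 ≤ 3 ^ t * Real.sin (ω * m) := le_trans (by positivity) hsin
    nlinarith [this, h3]
  obtain ⟨x, hx, h⟩ := exists_le_abs_cos_l1Norm_sub_eval_frozenMass ht hω hk hωk hm0 hm hsin0 P hP
  refine ⟨x, hx, le_trans ?_ h⟩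
  have hωk0 : 0 ≤ ω * k := mul_nonneg hω (Nat.cast_nonneg k)
  -- `6ωk/(3^t t) ≤ ωk sin(ωm)/(40πt)`
  have hhalf : 6 * (ω * k) / (3 ^ t * t) ≤ ω * k * Real.sin (ω * m) / (40 * π * t) := by
    rw [div_le_div_iff₀ (by positivity) (by positivity)]
    have h1 := mul_le_mul_of_nonneg_left hsin (mul_nonneg hωk0 ht0.le)
    nlinarith [h1, Real.pi_pos]
  have e : ω * k * Real.sin (ω * m) / (20 * π * t) = 2 * (ω * k * Real.sin (ω * m) / (40 * π * t)) := by
    field_simp; ring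
  rw [e]; linarith

/-- ★★ **THE COSINE FACE BELOW THE PERIOD.**  For `t ≥ 6`, `ω ≥ 0` with `ω⌊|ι|∕2⌋ ≤ t∕10` and `240π ≤ 3^t·sin(ω(|ι| − ⌊|ι|∕2⌋))` (which
holds throughout `240π∕3^t ≲ ω|ι| ≤ π`, the sub-period window this theorem is for), every `P : MvPolynomial ι ℝ` of total degree `≤ t` misses
`cos(ωΣ_i|x_i|)` by at least `ω⌊|ι|∕2⌋·sin(ω(|ι| − ⌊|ι|∕2⌋))∕(40πt)` somewhere on `[−1,1]^ι` (`k = ⌊|ι|∕2⌋` moving coordinates, the other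
`⌈|ι|∕2⌉` frozen at height `1`).  READING: `≍ ω²|ι|²∕t` for `ω|ι| ≤ π` (`sin y ≥ 2y∕π` on `[0, π∕2]`) — the second-order kink of CURRENCY-MAP
v10's open list, interpolating to module 135's `ω⌊|ι|∕2⌋∕(20πt)` at `ω⌈|ι|∕2⌉ = π∕2`. [folklore] -/
theorem exists_le_abs_cos_l1Norm_sub_eval_subPeriod {t : ℕ} (ht : 6 ≤ t) {ω : ℝ} (hω : 0 ≤ ω)
    (hωk : ω * ((Fintype.card ι / 2 : ℕ) : ℝ) ≤ t / 10)
    (hsin : 240 * π ≤ 3 ^ t * Real.sin (ω * ((Fintype.card ι : ℝ) - (Fintype.card ι / 2 : ℕ))))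
    (P : MvPolynomial ι ℝ) (hP : P.totalDegree ≤ t) :
    ∃ x : ι → ℝ, (∀ i, x i ∈ Set.Icc (-1 : ℝ) 1) ∧
      ω * ((Fintype.card ι / 2 : ℕ) : ℝ) * Real.sin (ω * ((Fintype.card ι : ℝ) - (Fintype.card ι / 2 : ℕ))) / (40 * π * t) ≤
        |Real.cos (ω * ∑ i, |x i|) - MvPolynomial.eval x P| := by
  have hk : Fintype.card ι / 2 ≤ Fintype.card ι := Nat.div_le_self _ 2
  have hm0 : (0 : ℝ) ≤ (Fintype.card ι : ℝ) - (Fintype.card ι / 2 : ℕ) :=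
    sub_nonneg.2 (by exact_mod_cast hk)
  exact exists_le_abs_cos_l1Norm_sub_eval_of_sin_ge ht hω hk hωk hm0 le_rfl hsin P hP

end Summit.QuantumFields.YangMills.Theorems.BalabanUVNodesN19CosModeLowerBoundSubPeriod

end
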